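import Summits.Schanuel.Schanuel.Theorems.ZilberEacSuperellipticConstFibre
import HarnessLib

/-!
# Arbitrary base branches, XLIX: the NORM over the two sheets of `x₁² = P(x₀)` — algebra for
# the general polynomial fibre `y₀ = A(x₀) + x₁B(x₀)`

HONEST FRAMING.  Cell `pub-schanuel` (Zilber's Exponential-Algebraic Closedness, case ladder;
host summit Schanuel), seat 2, gen 30.  Over a curve `C : x₁² = P(x₀)` every polynomial
`R(x₀, x₁)` is congruent modulo `x₁² − P(x₀)` to a unique `A(x₀) + x₁B(x₀)`
(**`exists_hyperelliptic_reduction`**), so the general polynomial fibre is `y₀ = A(x₀) + x₁B(x₀)`.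
To run the transcendence method of files XLIII–XLVII on such fibres one must eliminate `x₁` from
an algebraic relation `H(x₀, y₁) = 0` in which `y₁` carries the factor `A(x₀) + x₁B(x₀)`: this file
supplies the NORM over the two sheets `x₁ = ±z`, `z² = P(x₀)` — a polynomial `Hn ∈ ℂ[x][Y]` with
`Hn(x, Y) = H(x, (A + zB)Y)·H(x, (A − zB)Y)` whenever `z² = P(x)` (**`exists_sheetNorm`**, by
reduction modulo the monic `z² − P` in `ℂ[x][Y][z]`), and its non-vanishing
(**`sheetNorm_ne_zero`**): `H ≠ 0 ⟹ Hn ≠ 0` as soon as `A² − PB² ≠ 0`, which holds for every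
`(A, B) ≠ (0, 0)` when `P` has a simple root (**`sq_sub_mul_sq_ne_zero`**, parity of the root
multiplicity).  Pure algebra; no claim about EAC is made here.  EC(3,2) OPEN; NOT Schanuel's
conjecture; EAC ⇏ SC.
-/

noncomputable section

open Polynomial

set_option linter.dupNamespace false

namespace Summit.Schanuel.Schanuel.Theorems

section HyperellipticNorm

variable (P A B : ℂ[X])

/-! ## Part A. `A² − P·B² ≠ 0` -/

/-- **`A² − PB² ≠ 0`** for `(A, B) ≠ (0, 0)` when `P` has a simple root `r`: the multiplicity of
`r` in `A²` is even, in `PB²` odd. [folklore] -/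
theorem sq_sub_mul_sq_ne_zero {r : ℂ} (hr : P.IsRoot r) (hr1 : P.derivative.eval r ≠ 0)
    (hAB : A ≠ 0 ∨ B ≠ 0) : A ^ 2 - P * B ^ 2 ≠ 0 := by
  have hP0 : P ≠ 0 := by
    rintro rfl
    simp at hr1
  intro h
  have hAB2 : A ^ 2 = P * B ^ 2 := sub_eq_zero.1 h
  have hB0 : B ≠ 0 := by
    intro hB
    rw [hB, zero_pow two_ne_zero, mul_zero, pow_eq_zero_iff two_ne_zero] at hAB2
    rcases hAB with hA | hB'
    · exact hA hAB2
    · exact hB' hB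
  have hA0 : A ≠ 0 := by
    intro hA
    rw [hA, zero_pow two_ne_zero] at hAB2
    exact mul_ne_zero hP0 (pow_ne_zero 2 hB0) hAB2.symm
  have hmP : P.rootMultiplicity r = 1 := by
    have h1 : 0 < P.rootMultiplicity r := (Polynomial.rootMultiplicity_pos hP0).2 hr
    have h2 : ¬ 1 < P.rootMultiplicity r := by
      rw [Polynomial.one_lt_rootMultiplicity_iff_isRoot hP0]
      rintro ⟨-, h⟩
      exact hr1 h
    omega
  have hl := congrArg (Polynomial.rootMultiplicity r) hAB2
  rw [pow_two, pow_two, Polynomial.rootMultiplicity_mul (mul_ne_zero hA0 hA0),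
    Polynomial.rootMultiplicity_mul (mul_ne_zero hP0 (mul_ne_zero hB0 hB0)),
    Polynomial.rootMultiplicity_mul (mul_ne_zero hB0 hB0), hmP] at hl
  omega

/-- The value `(A + zB)(A − zB) = (A² − PB²)(x)` on the curve `z² = P(x)`. [folklore] -/
theorem sheet_mul_sheet_eq {x z : ℂ} (hz : z ^ 2 = P.eval x) :
    (A.eval x + z * B.eval x) * (A.eval x - z * B.eval x) = (A ^ 2 - P * B ^ 2).eval x := by
  simp only [Polynomial.eval_sub, Polynomial.eval_mul, Polynomial.eval_pow]
  rw [← hz]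
  ring

/-! ## Part B. The norm over the two sheets -/

/-- **The sheet norm.**  For `H ∈ ℂ[x][Y]` there is `Hn ∈ ℂ[x][Y]` with
`Hn(x, Y) = H(x, (A(x) + zB(x))Y)·H(x, (A(x) − zB(x))Y)` whenever `z² = P(x)`: reduce
`H(x, (A + zB)Y)` modulo the monic `z² − P` in `ℂ[x][Y][z]` to `E₀ + zE₁` and take
`Hn = E₀² − PE₁²`. [folklore] -/
theorem exists_sheetNorm (H : ℂ[X][X]) : ∃ Hn : ℂ[X][X], ∀ x z y : ℂ, z ^ 2 = P.eval x →
    (Hn.map (Polynomial.evalRingHom x)).eval y =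
      (H.map (Polynomial.evalRingHom x)).eval ((A.eval x + z * B.eval x) * y) *
        (H.map (Polynomial.evalRingHom x)).eval ((A.eval x - z * B.eval x) * y) := by
  classical
  -- `K = ℂ[x][Y]`; work in `K[z]` modulo `q = z² − P`
  set q : ℂ[X][X][X] := X ^ 2 - C (C P) with hq
  have hqm : q.Monic := by rw [hq]; exact Polynomial.monic_X_pow_sub_C _ two_ne_zero
  have hqdeg : q.natDegree = 2 := by rw [hq]; exact Polynomial.natDegree_X_pow_sub_C
  have hq1 : q ≠ 1 := by
    intro h
    have := congrArg Polynomial.natDegree h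
    rw [hqdeg, Polynomial.natDegree_one] at this
    exact absurd this (by norm_num)
  set ι : ℂ[X] →+* ℂ[X][X][X] := (C : ℂ[X][X] →+* ℂ[X][X][X]).comp C with hι
  set L : ℂ[X][X][X] := C (C A) + X * C (C B) with hL
  set E : ℂ[X][X][X] := H.eval₂ ι (L * C X) with hE
  set Er : ℂ[X][X][X] := E %ₘ q with hEr
  have hEr1 : Er.natDegree ≤ 1 := by
    have := Polynomial.natDegree_modByMonic_lt E hqm hq1
    rw [hqdeg, ← hEr] at this
    omega
  have hErXC : Er = C (Er.coeff 1) * X + C (Er.coeff 0) := Polynomial.eq_X_add_C_of_natDegree_le_one hEr1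
  refine ⟨Er.coeff 0 ^ 2 - C P * Er.coeff 1 ^ 2, fun x z y hz => ?_⟩
  -- evaluation `K → ℂ` at `(x, y)`
  set evK : ℂ[X][X] →+* ℂ := Polynomial.eval₂RingHom (Polynomial.evalRingHom x) y with hevKdef
  have hevK : ∀ F : ℂ[X][X], evK F = (F.map (Polynomial.evalRingHom x)).eval y := fun F => by
    rw [hevKdef, Polynomial.coe_eval₂RingHom, Polynomial.eval_map]
  -- the key identity on each sheet
  have key : ∀ z' : ℂ, z' ^ 2 = P.eval x →
      evK (Er.coeff 0) + z' * evK (Er.coeff 1) =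
        (H.map (Polynomial.evalRingHom x)).eval ((A.eval x + z' * B.eval x) * y) := by
    intro z' hz'
    set ev : ℂ[X][X][X] →+* ℂ := Polynomial.eval₂RingHom evK z' with hev
    have hevC : ∀ F : ℂ[X][X], ev (C F) = evK F := fun F => by
      rw [hev, Polynomial.coe_eval₂RingHom, Polynomial.eval₂_C]
    have hevX : ev X = z' := by rw [hev, Polynomial.coe_eval₂RingHom, Polynomial.eval₂_X]
    have hevKC : ∀ p : ℂ[X], evK (C p) = p.eval x := fun p => by
      rw [hevK, Polynomial.map_C, Polynomial.eval_C, Polynomial.coe_evalRingHom]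
    have hevKX : evK X = y := by rw [hevK, Polynomial.map_X, Polynomial.eval_X]
    have hevq : ev q = 0 := by
      rw [hq, map_sub ev, map_pow ev, hevX, hevC, hevKC, hz', sub_self]
    have hevE : ev E = (H.map (Polynomial.evalRingHom x)).eval ((A.eval x + z' * B.eval x) * y) := by
      rw [hE, Polynomial.hom_eval₂, Polynomial.eval_map]
      have hcomp : ev.comp ι = Polynomial.evalRingHom x := RingHom.ext fun p => by
        rw [RingHom.comp_apply, hι, RingHom.comp_apply, hevC, hevKC, Polynomial.coe_evalRingHom]
      have hval : ev (L * C X) = (A.eval x + z' * B.eval x) * y := by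
        rw [map_mul ev, hL, map_add ev, map_mul ev, hevX, hevC, hevC, hevC, hevKC, hevKC, hevKX]
      rw [hcomp, hval]
    have hevEr : ev Er = evK (Er.coeff 0) + z' * evK (Er.coeff 1) := by
      rw [hErXC, map_add ev, map_mul ev, hevC, hevC, hevX]
      simp only [Polynomial.coeff_add, Polynomial.coeff_C_mul, Polynomial.coeff_X_one,
        Polynomial.coeff_X_zero, Polynomial.coeff_C_zero, Polynomial.coeff_C_succ, mul_one,
        mul_zero, add_zero, zero_add]
      ring
    have hsplit : ev E = ev Er + ev q * ev (E /ₘ q) := by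
      rw [← map_mul ev, ← map_add ev, hEr, Polynomial.modByMonic_add_div]
    rw [← hevE, hsplit, hevq, zero_mul, add_zero, hevEr]
  have hneg : (-z) ^ 2 = P.eval x := by rw [neg_sq]; exact hz
  have k1 := key z hz
  have k2 := key (-z) hneg
  rw [← hevK, map_sub evK, map_mul evK, map_pow evK, map_pow evK]
  have hP' : evK (C P) = P.eval x := by
    rw [hevK, Polynomial.map_C, Polynomial.eval_C, Polynomial.coe_evalRingHom]
  rw [hP', show A.eval x - z * B.eval x = A.eval x + -z * B.eval x by ring, ← k1, ← k2, ← hz]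
  ring

/-- **If the product over the sheets vanishes identically, `H = 0`** (given `A² − PB² ≠ 0`): at a
point `x` with `(A² − PB²)(x)·h_j(x) ≠ 0` both scalings `Y ↦ (A ± zB)Y` are invertible, so one of
the two factors is the zero polynomial in `Y`, forcing `H(x, ·) = 0`. [folklore] -/
theorem eq_zero_of_sheetProduct_eq_zero (hN : A ^ 2 - P * B ^ 2 ≠ 0) (H : ℂ[X][X])
    (h : ∀ x z y : ℂ, z ^ 2 = P.eval x →
      (H.map (Polynomial.evalRingHom x)).eval ((A.eval x + z * B.eval x) * y) *
        (H.map (Polynomial.evalRingHom x)).eval ((A.eval x - z * B.eval x) * y) = 0) : H = 0 := by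
  classical
  by_contra hH
  obtain ⟨j, hj⟩ := Polynomial.support_nonempty.2 hH
  have hj' : H.coeff j ≠ 0 := Polynomial.mem_support_iff.1 hj
  have hprod : (A ^ 2 - P * B ^ 2) * H.coeff j ≠ 0 := mul_ne_zero hN hj'
  obtain ⟨x, hx⟩ : ∃ x, ((A ^ 2 - P * B ^ 2) * H.coeff j).eval x ≠ 0 := by
    by_contra hall
    push Not at hall
    exact hprod (Polynomial.funext (by simpa using hall))
  rw [Polynomial.eval_mul] at hx
  have hNx : (A ^ 2 - P * B ^ 2).eval x ≠ 0 := left_ne_zero_of_mul hx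
  have hjx : (H.coeff j).eval x ≠ 0 := right_ne_zero_of_mul hx
  obtain ⟨z, hz⟩ := IsAlgClosed.exists_pow_nat_eq (P.eval x) two_pos
  set Hx : ℂ[X] := H.map (Polynomial.evalRingHom x) with hHxdef
  have hHx : Hx ≠ 0 := by
    intro h0
    apply hjx
    have := congrArg (fun p : ℂ[X] => p.coeff j) h0
    simpa [hHxdef, Polynomial.coeff_map] using this
  have hlam : (A.eval x + z * B.eval x) * (A.eval x - z * B.eval x) ≠ 0 := by
    rw [sheet_mul_sheet_eq P A B hz]
    exact hNx
  set Pr : ℂ[X] := Hx.comp (C (A.eval x + z * B.eval x) * X) *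
    Hx.comp (C (A.eval x - z * B.eval x) * X) with hPr
  have hPr0 : Pr = 0 := by
    refine Polynomial.funext fun y => ?_
    have := h x z y hz
    simpa [hPr, Polynomial.eval_mul, Polynomial.eval_comp] using this
  have hcomp : ∀ lam : ℂ, lam ≠ 0 → Hx.comp (C lam * X) ≠ 0 := by
    intro lam hlam0 h0
    rw [Polynomial.comp_eq_zero_iff] at h0
    rcases h0 with h0 | ⟨-, h0⟩
    · exact hHx h0
    · have h1 := congrArg (fun p : ℂ[X] => p.coeff 1) h0
      simp only [Polynomial.coeff_C_mul, Polynomial.coeff_X_one, mul_one,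
        Polynomial.coeff_C_succ] at h1
      exact hlam0 h1
  rcases mul_eq_zero.1 hPr0 with h1 | h1
  · exact hcomp _ (left_ne_zero_of_mul hlam) h1
  · exact hcomp _ (right_ne_zero_of_mul hlam) h1

/-- **The sheet norm of a nonzero `H` is nonzero** (given `A² − PB² ≠ 0`). [folklore] -/
theorem sheetNorm_ne_zero (hN : A ^ 2 - P * B ^ 2 ≠ 0) (H : ℂ[X][X]) (hH : H ≠ 0)
    {Hn : ℂ[X][X]} (hHn : ∀ x z y : ℂ, z ^ 2 = P.eval x →
      (Hn.map (Polynomial.evalRingHom x)).eval y =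
        (H.map (Polynomial.evalRingHom x)).eval ((A.eval x + z * B.eval x) * y) *
          (H.map (Polynomial.evalRingHom x)).eval ((A.eval x - z * B.eval x) * y)) : Hn ≠ 0 := by
  intro h0
  apply hH
  refine eq_zero_of_sheetProduct_eq_zero P A B hN H fun x z y hz => ?_
  rw [← hHn x z y hz, h0]
  simp

/-! ## Part C. Every polynomial fibre reduces to `A(x₀) + x₁B(x₀)` -/

/-- **Reduction modulo `x₁² − P(x₀)`**: every `R ∈ ℂ[x₀, x₁]` is
`A(x₀) + x₁B(x₀) + (x₁² − P(x₀))·Q`. [folklore] -/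
theorem exists_hyperelliptic_reduction (R : MvPolynomial (Fin 2) ℂ) :
    ∃ (A' B' : ℂ[X]) (Q : MvPolynomial (Fin 2) ℂ),
      R = Polynomial.aeval (MvPolynomial.X 0 : MvPolynomial (Fin 2) ℂ) A' +
        MvPolynomial.X 1 * Polynomial.aeval (MvPolynomial.X 0 : MvPolynomial (Fin 2) ℂ) B' +
        (MvPolynomial.X 1 ^ 2 - Polynomial.aeval (MvPolynomial.X 0 : MvPolynomial (Fin 2) ℂ) P) * Q := by
  induction R using MvPolynomial.induction_on with
  | C a =>
    refine ⟨Polynomial.C a, 0, 0, ?_⟩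
    simp [MvPolynomial.algebraMap_eq]
  | add p q hp hq =>
    obtain ⟨A₁, B₁, Q₁, h₁⟩ := hp
    obtain ⟨A₂, B₂, Q₂, h₂⟩ := hq
    refine ⟨A₁ + A₂, B₁ + B₂, Q₁ + Q₂, ?_⟩
    rw [h₁, h₂]
    simp only [map_add]
    ring
  | mul_X p i hp =>
    obtain ⟨A₁, B₁, Q₁, h₁⟩ := hp
    fin_cases i
    · refine ⟨X * A₁, X * B₁, Q₁ * MvPolynomial.X 0, ?_⟩
      rw [h₁]
      simp only [map_mul, Polynomial.aeval_X, Fin.zero_eta]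
      ring
    · refine ⟨P * B₁, A₁, Q₁ * MvPolynomial.X 1 +
        Polynomial.aeval (MvPolynomial.X 0 : MvPolynomial (Fin 2) ℂ) B₁, ?_⟩
      rw [h₁]
      simp only [map_mul, Fin.mk_one]
      ring

/-- Evaluation of the reduced fibre polynomial `A(x₀) + x₁B(x₀)`. -/
theorem eval_sheetFibreMv (x : Fin 2 → ℂ) :
    MvPolynomial.eval x (Polynomial.aeval (MvPolynomial.X 0 : MvPolynomial (Fin 2) ℂ) A +
        MvPolynomial.X 1 * Polynomial.aeval (MvPolynomial.X 0 : MvPolynomial (Fin 2) ℂ) B) =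
      A.eval (x 0) + x 1 * B.eval (x 0) := by
  rw [map_add, map_mul, MvPolynomial.eval_X, Literature.ModelTheory.Zilber.eval_polynomial_aeval_X,
    Literature.ModelTheory.Zilber.eval_polynomial_aeval_X]

/-- **The surfaces agree**: on the curve `x₁² = P(x₀)` the fibre `y₀ = R(x₀, x₁)` equals the fibre
`y₀ = A(x₀) + x₁B(x₀)` of its reduction. [folklore] -/
theorem curveGraphFibre_eq_of_reduction (R Q : MvPolynomial (Fin 2) ℂ)
    (hR : R = Polynomial.aeval (MvPolynomial.X 0 : MvPolynomial (Fin 2) ℂ) A +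
        MvPolynomial.X 1 * Polynomial.aeval (MvPolynomial.X 0 : MvPolynomial (Fin 2) ℂ) B +
        (MvPolynomial.X 1 ^ 2 - Polynomial.aeval (MvPolynomial.X 0 : MvPolynomial (Fin 2) ℂ) P) * Q) :
    {w : Fin 2 ⊕ Fin 2 → ℂ |
      MvPolynomial.eval ![w (Sum.inl 0), w (Sum.inl 1)]
          (MvPolynomial.X 1 ^ 2 - Polynomial.aeval (MvPolynomial.X 0 : MvPolynomial (Fin 2) ℂ) P) = 0 ∧
      w (Sum.inr 0) = MvPolynomial.eval ![w (Sum.inl 0), w (Sum.inl 1)] R} =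
    {w : Fin 2 ⊕ Fin 2 → ℂ |
      MvPolynomial.eval ![w (Sum.inl 0), w (Sum.inl 1)]
          (MvPolynomial.X 1 ^ 2 - Polynomial.aeval (MvPolynomial.X 0 : MvPolynomial (Fin 2) ℂ) P) = 0 ∧
      w (Sum.inr 0) = MvPolynomial.eval ![w (Sum.inl 0), w (Sum.inl 1)]
        (Polynomial.aeval (MvPolynomial.X 0 : MvPolynomial (Fin 2) ℂ) A +
          MvPolynomial.X 1 * Polynomial.aeval (MvPolynomial.X 0 : MvPolynomial (Fin 2) ℂ) B)} := by
  ext w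
  simp only [Set.mem_setOf_eq]
  have key : MvPolynomial.eval ![w (Sum.inl 0), w (Sum.inl 1)]
      (MvPolynomial.X 1 ^ 2 - Polynomial.aeval (MvPolynomial.X 0 : MvPolynomial (Fin 2) ℂ) P) = 0 →
      MvPolynomial.eval ![w (Sum.inl 0), w (Sum.inl 1)] R =
        MvPolynomial.eval ![w (Sum.inl 0), w (Sum.inl 1)]
          (Polynomial.aeval (MvPolynomial.X 0 : MvPolynomial (Fin 2) ℂ) A +
            MvPolynomial.X 1 * Polynomial.aeval (MvPolynomial.X 0 : MvPolynomial (Fin 2) ℂ) B) := by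
    intro h1
    rw [hR, map_add (MvPolynomial.eval _) _ (_ * Q), map_mul (MvPolynomial.eval _) _ Q, h1,
      zero_mul, add_zero]
  refine ⟨fun ⟨h1, h2⟩ => ⟨h1, ?_⟩, fun ⟨h1, h2⟩ => ⟨h1, ?_⟩⟩
  · rw [h2, key h1]
  · rw [h2, ← key h1]

end HyperellipticNorm

end Summit.Schanuel.Schanuel.Theorems

end
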